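import Literature.NumberTheory.LFunctions.DobnerSelbergClassSteepestContourProofs
import Literature.NumberTheory.LFunctions.DobnerSelbergClassSteepestSaddleProofs
import Literature.NumberTheory.LFunctions.DobnerSelbergClassSummationProofs
import Literature.NumberTheory.LFunctions.DobnerSelbergClassNewmanProofs
import HarnessLib

/-!
# Dobner's Lemma 4, Theorem 4 (qualitative) and Theorem 2 (`Λ_F ≥ 0`) for the extended Selberg class

RH-FREE literature PROOFS (no definitions, no named facts; one DISCHARGE). Trunk T-ANT
(`Literature/NumberTheory/LFunctions`); the ASSEMBLY node of the Dobner-T2 (`𝒮♯`) programme of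
cell rh-crit (plan of record HOME/drafts/rt/t7-N1-PLAN.md, rt-lead rulings (22)/(26)/(27),
rt/STATUS 2026-08-26). It puts together the tree theorems

* L4a `ExtendedSelbergDatum.dobnerB_large` (`DobnerSelbergClassSteepestLargeProofs.lean`, seat
  rt-t6): Lemma 4 (iii), large `n`;
* L4b `ExtendedSelbergDatum.dobner_lemma4_contour` (`DobnerSelbergClassSteepestContourProofs.lean`,
  seat rt-iso): the rectangle contour `V₁, H₁, H₂, V₂` of the proof of Lemma 4 (i)/(ii);
* L4c-S `ExtendedSelbergDatum.dobner_lemma4_segment` (`DobnerSelbergClassSteepestSaddleProofs.lean`,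
  seat rt-t7): the saddle-point segment `M` (Lemma 5 applied, Gaussian main term);
* N2 `ExtendedSelbergDatum.xiDeformed_approx_of` (`DobnerSelbergClassSummationProofs.lean`, seat
  rt-t6): §4.1, the summation `ξ^F_t(J_t(s)) = ∑ aₙ B_{t,n}(s)` ⟹ qualitative Thm. 4, in
  hypothesis form over Lemma 4♯;
* N5 `Literature.NumberTheory.LFunctions.dobner_theorem2_of` (`DobnerSelbergClassNewmanProofs.lean`,
  seat rt-t4): §3.1 (Bohr almost periodicity, Lemma 3, Rouché/Hurwitz) ⟹ Thm. 2, in hypothesis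
  form over the qualitative Thm. 4;

into

* **`ExtendedSelbergDatum.dobner_lemma4`** — Dobner's **Lemma 4** for every `F ∈ 𝒮♯` with
  `k ≥ 1` (the frozen signature of record, HOME/drafts/rt/t7-FROZEN-SIGNATURES.lean; the `ζ`-case is
  the tree theorem `Literature.NumberTheory.LFunctions.dobner_lemma4_holds`);
* **`ExtendedSelbergDatum.xiDeformed_approx`** — the qualitative **Theorem 4**:
  `ξ^F_t(J_t(s)) = γ_t(s)(F_t(s) + o_{y→∞}(1))` uniformly in vertical strips (frozen signature of
  record; `ζ`-case: `Literature.NumberTheory.LFunctions.dobner_xiDeformed_approx_holds`);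
* **`Literature.NumberTheory.LFunctions.dobner_theorem2_holds : dobner_theorem2`** — the DISCHARGE of
  the named fact `Literature.NumberTheory.LFunctions.dobner_theorem2` of `DobnerSelbergClass.lean`
  (**Dobner 2021, Thm. 2**: for every `F ∈ 𝒮♯` (`k ≥ 1`) and every `t < 0`, `ξ^F_t` has a zero off
  the critical line, i.e. `Λ_F ≥ 0`), and the printed form
  `ExtendedSelbergDatum.dbnConst_nonneg_of_theorem1 : dobner_theorem1 → 0 ≤ Λ_F` (Thm. 1, the
  existence of `Λ_F`, is still the named fact `Literature.NumberTheory.LFunctions.dobner_theorem1`).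

> A. Dobner, *A proof of Newman's conjecture for the extended Selberg class*, Acta Arith. 201
> (2021) = arXiv:2005.05142 (held; page numbers of the 18-page arXiv text): **Thm. 2** (p. 3)
> "`Λ_F ≥ 0` for every `F ∈ 𝒮♯`"; §3 p. 8 "To prove `Λ_F ≥ 0`, we will take a direct approach by
> showing that for every `t < 0` the function `ξ^F_t` has zeros off the critical line"; **Thm. 4**
> (p. 8) and its qualitative version (display following it); **Lemma 4** (p. 10), proof pp. 11–13;
> §4.1 (pp. 13–14); §3.1 (pp. 8–9).

As in the `ζ`-case files, `J_t`/`A` are the tree's exact-cancellation variants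
(`DobnerSelbergClassSteepest.lean`, "DEVIATION FROM PRINT", rt-lead ruling (15)(c)); no printed
STATEMENT is typed in deviated form — Thm. 2 does not mention `J_t`.

bears_on: N-C/N-P (COLUMN 3 DBN). WHAT THIS IS NOT: `Λ_F ≥ 0` for the extended Selberg class is
RH-FREE published mathematics (its `ζ`-case `Λ ≥ 0` is the kernel theorem
`Literature.NumberTheory.LFunctions.rodgers_tao_holds`); it is the `𝒮♯`-generalisation of a sign
theorem and says nothing about RH or GRH; nothing here bears on the truth of RH.
-/

noncomputable section

open Complex Filter Topology Set MeasureTheory intervalIntegral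

namespace Literature.NumberTheory.LFunctions

namespace ExtendedSelbergDatum

variable (D : ExtendedSelbergDatum)


/-- **Dobner's Lemma 4 for the extended Selberg class** (`k ≥ 1`, fixed `t < 0`, `C > 0`): there
are `y₀` and `K > 0` such that for `|Re s| ≤ C (Im s)^{1/4}`, `Im s ≥ y₀`, `n ≥ 1`, with
`B_{t,n}(s) = ExtendedSelbergDatum.dobnerB` and the main term `γ_t(s) e^{−(|t|/4)log² n} n^{−s}`:
(i) `log n ≤ y^{1/3}/|t| ⟹ ‖B_{t,n}(s) − main‖ ≤ K y^{−1/5} ‖main‖`;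
(ii) `log n ≤ y^{3/5}/|t| ⟹ ‖B_{t,n}(s)‖ ≤ K ‖γ_t(s)‖ e^{−(|t|/8)log² n} n^{−Re s}`;
(iii) `log n > y^{3/5}/|t| ⟹ ‖B_{t,n}(s)‖ ≤ K e^{−(|t|/10) log² n}` ("Let `t`, `s = x+iy`, and
`C` satisfy the same restrictions as in Theorem 4. Then for all `y` sufficiently large (depending on
`C`) …", p. 10; as in the `ζ`-case fact `Literature.NumberTheory.LFunctions.dobner_lemma4`, recorded
for each fixed `t < 0`, which is weaker than the printed uniformity in `|t| ≤ C`). Assembly: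
`B − main = (B − (π|t|)^{−1/2}M) + ((π|t|)^{−1/2}M − main)` with the contour step
`ExtendedSelbergDatum.dobner_lemma4_contour`, the segment step
`ExtendedSelbergDatum.dobner_lemma4_segment` (incl. the absorption `e^{−y^{4/3}/(18|t|)} ≤ y^{−1/5}‖main‖`)
and the large-`n` step `ExtendedSelbergDatum.dobnerB_large`. [cite: Dobner2021, Lemma 4, p. 10] -/
theorem dobner_lemma4 (hk : 0 < D.numGamma) {t : ℝ} (ht : t < 0) {C : ℝ} (hC : 0 < C) :
    ∃ y₀ K : ℝ, 0 < K ∧ ∀ s : ℂ, |s.re| ≤ C * s.im ^ (1 / 4 : ℝ) → y₀ ≤ s.im → ∀ n : ℕ, 1 ≤ n →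
      (Real.log n ≤ s.im ^ (1 / 3 : ℝ) / |t| →
        ‖D.dobnerB t n s - D.dobnerMainTerm t n s‖ ≤
          K * s.im ^ (-(1 / 5 : ℝ)) * ‖D.dobnerMainTerm t n s‖) ∧
      (Real.log n ≤ s.im ^ (3 / 5 : ℝ) / |t| →
        ‖D.dobnerB t n s‖ ≤ K * ‖D.dobnerGammaT t s‖ * Real.exp (-(|t| / 8) * Real.log n ^ 2) *
          (n : ℝ) ^ (-s.re)) ∧
      (s.im ^ (3 / 5 : ℝ) / |t| < Real.log n →
        ‖D.dobnerB t n s‖ ≤ K * Real.exp (-(|t| / 10) * Real.log n ^ 2)) := by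
  have hτ : 0 < |t| := abs_pos.2 ht.ne
  obtain ⟨y₁, K₁, hK₁, h₁⟩ := D.dobner_lemma4_segment hk ht hC
  obtain ⟨y₂, h₂⟩ := D.dobner_lemma4_contour hk ht C
  obtain ⟨y₃, K₃, hK₃, h₃⟩ := D.dobnerB_large ht C
  refine ⟨max (max y₁ y₂) (max y₃ 1), max (K₁ + 1) K₃, lt_max_of_lt_left (by linarith),
    fun s hx hy n hn ↦ ?_⟩
  have hy1 : y₁ ≤ s.im := ((le_max_left _ _).trans (le_max_left _ _)).trans hy
  have hy2 : y₂ ≤ s.im := ((le_max_right _ _).trans (le_max_left _ _)).trans hy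
  have hy3 : y₃ ≤ s.im := ((le_max_left _ _).trans (le_max_right _ _)).trans hy
  have hy0 : 1 ≤ s.im := ((le_max_right _ _).trans (le_max_right _ _)).trans hy
  have hypos : 0 < s.im := by linarith
  set cM : ℂ := ((1 / Real.sqrt (Real.pi * |t|) : ℝ) : ℂ) *
    ∫ u in (-(s.im ^ (2 / 3 : ℝ)))..(s.im ^ (2 / 3 : ℝ)),
      D.dobnerI t n s (D.dobnerCenter t n s + u * I) with hcM
  set w : ℝ := s.im ^ (-(1 / 5 : ℝ)) with hw
  have hw0 : 0 ≤ w := Real.rpow_nonneg hypos.le _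
  have hw1 : w ≤ 1 := Real.rpow_le_one_of_one_le_of_nonpos hy0 (by norm_num)
  obtain ⟨hi, hii⟩ := h₁ s hx hy1 n hn
  have h13_35 : s.im ^ (1 / 3 : ℝ) / |t| ≤ s.im ^ (3 / 5 : ℝ) / |t| :=
    div_le_div_of_nonneg_right (Real.rpow_le_rpow_of_exponent_le hy0 (by norm_num)) hτ.le
  refine ⟨fun h13 ↦ ?_, fun h35 ↦ ?_, fun hlarge ↦ ?_⟩
  · -- part (i)
    have hreg := h13.trans h13_35
    have hc := h₂ s hx hy2 n hn hreg
    obtain ⟨-, hΔ⟩ := hii hreg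
    have hseg := hi h13
    have e : D.dobnerB t n s - D.dobnerMainTerm t n s =
        (D.dobnerB t n s - cM) + (cM - D.dobnerMainTerm t n s) := by ring
    rw [e]
    calc ‖(D.dobnerB t n s - cM) + (cM - D.dobnerMainTerm t n s)‖
        ≤ ‖D.dobnerB t n s - cM‖ + ‖cM - D.dobnerMainTerm t n s‖ := norm_add_le _ _
      _ ≤ w * ‖D.dobnerMainTerm t n s‖ + K₁ * w * ‖D.dobnerMainTerm t n s‖ :=
          add_le_add (hc.trans hΔ) hseg
      _ = (K₁ + 1) * w * ‖D.dobnerMainTerm t n s‖ := by ring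
      _ ≤ max (K₁ + 1) K₃ * w * ‖D.dobnerMainTerm t n s‖ := by
          gcongr; exact le_max_left _ _
  · -- part (ii)
    have hc := h₂ s hx hy2 n hn h35
    obtain ⟨hM, hΔ⟩ := hii h35
    set W : ℝ := ‖D.dobnerGammaT t s‖ * Real.exp (-(|t| / 8) * Real.log n ^ 2) * (n : ℝ) ^ (-s.re)
      with hW
    have hW0 : 0 ≤ W := by positivity
    have hmainW : ‖D.dobnerMainTerm t n s‖ ≤ W := by
      rw [D.norm_dobnerMainTerm_eq t hn s, hW]
      have hℓ : 0 ≤ |t| * Real.log n ^ 2 := by positivity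
      have : Real.exp (-(|t| / 4) * Real.log n ^ 2) ≤ Real.exp (-(|t| / 8) * Real.log n ^ 2) :=
        Real.exp_le_exp.2 (by linarith)
      have h0 : 0 ≤ (n : ℝ) ^ (-s.re) := Real.rpow_nonneg n.cast_nonneg _
      gcongr
    have e : D.dobnerB t n s = (D.dobnerB t n s - cM) + cM := by ring
    rw [e]
    calc ‖(D.dobnerB t n s - cM) + cM‖ ≤ ‖D.dobnerB t n s - cM‖ + ‖cM‖ := norm_add_le _ _
      _ ≤ w * ‖D.dobnerMainTerm t n s‖ + K₁ * W := by
          refine add_le_add (hc.trans hΔ) ?_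
          rw [hW]
          calc ‖cM‖ ≤ K₁ * ‖D.dobnerGammaT t s‖ * Real.exp (-(|t| / 8) * Real.log n ^ 2) *
                (n : ℝ) ^ (-s.re) := hM
            _ = _ := by ring
      _ ≤ 1 * W + K₁ * W := by
          gcongr
      _ = (K₁ + 1) * W := by ring
      _ ≤ max (K₁ + 1) K₃ * W := mul_le_mul_of_nonneg_right (le_max_left _ _) hW0
      _ = _ := by rw [hW]; ring
  · -- part (iii)
    calc ‖D.dobnerB t n s‖ ≤ K₃ * Real.exp (-(|t| / 10) * Real.log n ^ 2) := h₃ s hx hy3 n hn hlarge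
      _ ≤ max (K₁ + 1) K₃ * Real.exp (-(|t| / 10) * Real.log n ^ 2) :=
          mul_le_mul_of_nonneg_right (le_max_right _ _) (Real.exp_pos _).le

/-- **Dobner's Theorem 4, qualitative version, for `F ∈ 𝒮♯`** ("if `t < 0`, `V` is some vertical
strip, and `s = x + iy ∈ V` with `y` sufficiently large, then `ξ^F_t(J_t(s)) = γ_t(s)(F_t(s) +
o_{y→∞}(1))` where the decay of the error term is uniform in `x`", display following Thm. 4,
p. 8): Lemma 4♯ (`ExtendedSelbergDatum.dobner_lemma4`) fed into the §4.1 summation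
(`ExtendedSelbergDatum.xiDeformed_approx_of`, `DobnerSelbergClassSummationProofs.lean`).
[cite: Dobner2021, Thm. 4 (qualitative version) and §4.1, pp. 8, 13–14] -/
theorem xiDeformed_approx (hk : 0 < D.numGamma) {t : ℝ} (ht : t < 0)
    (a b : ℝ) (hab : a ≤ b) {ε : ℝ} (hε : 0 < ε) :
    ∃ y₀ : ℝ, ∀ s : ℂ, a ≤ s.re → s.re ≤ b → y₀ ≤ s.im →
      ‖D.xiDeformed t (D.dobnerJ t s) - D.dobnerGammaT t s * D.Ft t s‖ ≤ ε * ‖D.dobnerGammaT t s‖ :=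
  D.xiDeformed_approx_of hk ht (fun _ hC ↦ D.dobner_lemma4 hk ht hC) a b hab hε

end ExtendedSelbergDatum

/-- **Dobner's Theorem 2 holds**: the named fact `Literature.NumberTheory.LFunctions.dobner_theorem2`
("`Λ_F ≥ 0` for every `F ∈ 𝒮♯`", typed as §3 proves it: for every datum with `k ≥ 1` and every
`t < 0`, `H_t` has a non-real zero) is a THEOREM of this library: the qualitative Thm. 4
(`ExtendedSelbergDatum.xiDeformed_approx`, this file, from Lemma 4♯ by steepest descent) fed into
the §3.1 argument `Literature.NumberTheory.LFunctions.dobner_theorem2_of`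
(`DobnerSelbergClassNewmanProofs.lean`: Bohr almost periodicity of `F_t`, a zero of `F_t` =
Lemma 3 `ExtendedSelbergDatum.Ft_exists_zero`, Hurwitz). Every input is a theorem of this library;
users of `(h : dobner_theorem2)` are fed this. RH-FREE (the `ζ`-case is
`Literature.NumberTheory.LFunctions.rodgers_tao_holds`). [cite: Dobner2021, Thm. 2, p. 3 (proof §3–§4)] -/
theorem dobner_theorem2_holds : dobner_theorem2 :=
  dobner_theorem2_of fun D hk _ ht a b hab _ hε ↦ D.xiDeformed_approx hk ht a b hab hε

/-- **The printed form `Λ_F ≥ 0`**, for the constant `Λ_F = ExtendedSelbergDatum.dbnConst`, given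
Thm. 1 (existence of `Λ_F`, still the named fact `Literature.NumberTheory.LFunctions.dobner_theorem1`):
`ExtendedSelbergDatum.dbnConst_nonneg` with its Thm. 2 input discharged. [cite: Dobner2021, Thm. 2, p. 3] -/
theorem ExtendedSelbergDatum.dbnConst_nonneg_of_theorem1 (D : ExtendedSelbergDatum)
    (h₁ : dobner_theorem1) (hk : 0 < D.numGamma) : 0 ≤ D.dbnConst :=
  D.dbnConst_nonneg h₁ dobner_theorem2_holds hk

end Literature.NumberTheory.LFunctions

end
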